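import Mathlib
import HarnessLib
import Literature.Computability.Complexity.CNF
import Literature.Computability.Complexity.PNPWave0
import Literature.Computability.Complexity.PNPWave0Proofs
import Summits.PneNP.PneNP.Theses.OverlapGapAlgebra
import Summits.PneNP.PneNP.Theorems.OverlapGapAlgebraSearchHardWindowCore
import Summits.PneNP.PneNP.Theorems.OverlapGapAlgebraSearchHardWindowExactCouplings
import Summits.PneNP.PneNP.Theorems.OverlapGapAlgebraSearchHardWindowRequotPolyTime
import Summits.PneNP.PneNP.Theorems.OverlapGapAlgebraSearchHardWindowStretchPolyTime
import Summits.PneNP.PneNP.Theorems.OverlapGapAlgebraSearchHardWindowRetruncPolyTime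

/-!
# PneNP / OverlapGapAlgebra — `SearchHardWindow` (stmt-PneNP-2460): DETERMINISTIC monotonicity of the hardness conjunct

Line `IdeaSketch_r2_k6` of crux stmt-PneNP-2460 (lead a1). Write `H(k, α)` for the hardness
conjunct of the crux at `(k, α)` — every polynomial-time word function `f` (input the
`encodingCNF`-code of the clause list, output word read as the table `v ↦ y.getD v false`) solves
`F_k(n, ⌊α n⌋)` with probability `→ 0` — stated INLINE below exactly as in the route decl. Then,
unconditionally and in the decl's own model (uniform, deterministic, no coins, no advice, no
padding):

* `shwQ_hardAt_mul_of_hardAt`  : `H(k, α) → H(k, q · α)` for every integer `q ≥ 1`;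
* `shwQ_hardAt_of_hardAt_succ` : `H(k + 1, α) → H(k, α)`;
* `shwQ_hardAt_flow`           : `H(k + j, α) → H(k, q · α)`;
* `shwQ_searchHardWindow_of_hardAt_flow` : for `k ≥ 1024` and `q · α` below the Achlioptas–Peres
  radius, `H(k + j, α)` already gives the crux `SearchHardWindow` (with the tree's
  `searchHardWindow_of_hard_below_rho`) — the composition of the line's skeleton with its kernel
  as an explicit hypothesis; `shwQ_searchHardWindow_of_hardAt_succ` is the pure width step.

Mechanism: the exact self-couplings of `OverlapGapAlgebraSearchHardWindowExactCouplings.lean`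
(variable quotient `v ↦ v / q`, first-literal truncation; `shwQ_wordRatio_quot`,
`shwQ_wordRatio_trunc`) and the polynomial-time word transcoders landed as the line's brick stubs
(`stub_requotPolyTime`, `stub_stretchPolyTime`, `stub_retruncPolyTime`), assembled here into
`shwQ_quotTranscoding` (`f = stretch_q ∘ f' ∘ requot_q`) and `shwQ_truncTranscoding`
(`f = f' ∘ retrunc`) by closure of `IsPolyTime` under composition (`IsPolyTime.comp`).

What this settles on the record of the crux: the set `{(k, α) | H(k, α)}` is an up-set under
integer dilations of the density and a down-set in the clause width, DETERMINISTICALLY — contrary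
to `Cruxes/SearchHardWindow/STRATEGY-CENSUS.md` §S3 ("upward-monotone in α [only] for advice-taking /
randomised solvers") and `BarrierNotes-r2-k4.md` §N7(a) ("H as typed is neither provably monotone in
α … by these means"): no fresh clauses are padded, variables are merged. It is bookkeeping, not a
lever on `H` itself (the couplings are complexity-free; the lex-least solver lifts too, cf.
`Theorems/SearchHardWindow/Negative/FalseWithoutPolyTime.lean`).

No definitions are introduced. Lead prover-line-stmt-PneNP-2460-a1-0, 2026-08-16.
-/

namespace Summit.PneNP.PneNP.Theorems

set_option linter.dupNamespace false -- `Summit.PneNP.PneNP.…`: summit = sub-problem (D-0017)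

open Finset Filter Literature.Computability.Complexity
open Summit.PneNP.PneNP.Theses.OverlapGapAlgebra
open scoped Classical

/-! ## The two word transcodings are available to polynomial time -/

/-- **Quotient transcoding.** For every polynomial-time `f'` and every `q ≥ 1` there is a
polynomial-time `f` — namely `stretch_q ∘ f' ∘ requot_q` — whose answer table on the code of any
clause list `L` is the `q`-fold stretch of `f'`'s table on the code of `L` with every literal
`(v, b)` replaced by `(v / q, b)`. [folklore] -/
theorem shwQ_quotTranscoding (q : ℕ) (hq : 0 < q) (f' : List Bool → List Bool)
    (hf' : IsPolyTime f') :
    ∃ f : List Bool → List Bool, IsPolyTime f ∧ ∀ (L : List (List (ℕ × Bool))) (v : ℕ),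
      (f (encodingCNF.encode L)).getD v false =
        (f' (encodingCNF.encode (L.map fun c => c.map fun l => (l.1 / q, l.2)))).getD (v / q) false := by
  obtain ⟨r, hr, hrspec⟩ := stub_requotPolyTime q
  obtain ⟨s, hs, hsspec⟩ := stub_stretchPolyTime q hq
  exact ⟨s ∘ (f' ∘ r), (hr.comp hf').comp hs, fun L v => by
    rw [Function.comp_apply, Function.comp_apply, hsspec, hrspec]⟩

/-- **Truncation transcoding.** For every polynomial-time `f'` there is a polynomial-time `f` —
namely `f' ∘ retrunc` — with `f (code L) = f' (code (L.map List.tail))` for every clause list `L`.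
[folklore] -/
theorem shwQ_truncTranscoding (f' : List Bool → List Bool) (hf' : IsPolyTime f') :
    ∃ f : List Bool → List Bool, IsPolyTime f ∧ ∀ L : List (List (ℕ × Bool)),
      f (encodingCNF.encode L) = f' (encodingCNF.encode (L.map List.tail)) := by
  obtain ⟨t, ht, htspec⟩ := stub_retruncPolyTime
  exact ⟨f' ∘ t, ht.comp hf', fun L => by rw [Function.comp_apply, htspec]⟩

/-! ## Monotonicity of the hardness conjunct -/

/-- **Deterministic upward monotonicity in the density.** If every polynomial-time word function
solves `F_k(n, ⌊α n⌋)` with probability `→ 0`, then the same holds for `F_k(n, ⌊q α n⌋)`, for every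
integer `q ≥ 1`: a solver `f'` at density `q α` is run on the quotient instance (variables merged
in blocks of `q`) and its table stretched back; by `shwQ_wordRatio_quot` the success ratio of this
polynomial-time `f` on `F_k(n' q, ⌊α n' q⌋)` equals that of `f'` on `F_k(n', ⌊q α n'⌋)`. [folklore] -/
theorem shwQ_hardAt_mul_of_hardAt {k q : ℕ} (hq : 0 < q) {α : ℝ}
    (hH : ∀ f : List Bool → List Bool, IsPolyTime f → ∀ ε : ℝ, 0 < ε →
      ∀ᶠ n : ℕ in atTop, ∀ m : ℕ, m = ⌊α * n⌋₊ →
        ((Finset.univ.filter fun Φ : Fin m → Fin k → Fin n × Bool => ∀ i, ∃ j,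
          (f (encodingCNF.encode (List.ofFn fun a => List.ofFn fun b =>
            (((Φ a b).1 : ℕ), (Φ a b).2)))).getD (Φ i j).1 false = (Φ i j).2).card : ℝ) /
          Fintype.card (Fin m → Fin k → Fin n × Bool) ≤ ε) :
    ∀ f : List Bool → List Bool, IsPolyTime f → ∀ ε : ℝ, 0 < ε →
      ∀ᶠ n : ℕ in atTop, ∀ m : ℕ, m = ⌊(q : ℝ) * α * n⌋₊ →
        ((Finset.univ.filter fun Φ : Fin m → Fin k → Fin n × Bool => ∀ i, ∃ j,
          (f (encodingCNF.encode (List.ofFn fun a => List.ofFn fun b =>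
            (((Φ a b).1 : ℕ), (Φ a b).2)))).getD (Φ i j).1 false = (Φ i j).2).card : ℝ) /
          Fintype.card (Fin m → Fin k → Fin n × Bool) ≤ ε := by
  intro f' hf' ε hε
  obtain ⟨f, hf, hff'⟩ := shwQ_quotTranscoding q hq f' hf'
  obtain ⟨N, hN⟩ := eventually_atTop.1 (hH f hf ε hε)
  refine eventually_atTop.2 ⟨N, fun n' hn' m hm => ?_⟩
  have hn : N ≤ n' * q := le_trans hn' (Nat.le_mul_of_pos_right _ hq)
  have hm' : m = ⌊α * ((n' * q : ℕ) : ℝ)⌋₊ := by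
    rw [hm]; congr 1; push_cast; ring
  have key := hN (n' * q) hn m hm'
  rwa [shwQ_wordRatio_quot hq hff' m k n'] at key

/-- **Downward monotonicity in the clause width.** If every polynomial-time word function solves
`F_{k+1}(n, ⌊α n⌋)` with probability `→ 0`, then the same holds for `F_k(n, ⌊α n⌋)`: a solver `f'`
for width `k` run on the truncated instance solves the `(k+1)`-instance at least as often
(`shwQ_wordRatio_trunc`; the first `k` literals of a uniform `(k+1)`-clause are a uniform
`k`-clause in the with-replacement literal model). [folklore] -/
theorem shwQ_hardAt_of_hardAt_succ {k : ℕ} {α : ℝ}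
    (hH : ∀ f : List Bool → List Bool, IsPolyTime f → ∀ ε : ℝ, 0 < ε →
      ∀ᶠ n : ℕ in atTop, ∀ m : ℕ, m = ⌊α * n⌋₊ →
        ((Finset.univ.filter fun Φ : Fin m → Fin (k + 1) → Fin n × Bool => ∀ i, ∃ j,
          (f (encodingCNF.encode (List.ofFn fun a => List.ofFn fun b =>
            (((Φ a b).1 : ℕ), (Φ a b).2)))).getD (Φ i j).1 false = (Φ i j).2).card : ℝ) /
          Fintype.card (Fin m → Fin (k + 1) → Fin n × Bool) ≤ ε) :
    ∀ f : List Bool → List Bool, IsPolyTime f → ∀ ε : ℝ, 0 < ε →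
      ∀ᶠ n : ℕ in atTop, ∀ m : ℕ, m = ⌊α * n⌋₊ →
        ((Finset.univ.filter fun Φ : Fin m → Fin k → Fin n × Bool => ∀ i, ∃ j,
          (f (encodingCNF.encode (List.ofFn fun a => List.ofFn fun b =>
            (((Φ a b).1 : ℕ), (Φ a b).2)))).getD (Φ i j).1 false = (Φ i j).2).card : ℝ) /
          Fintype.card (Fin m → Fin k → Fin n × Bool) ≤ ε := by
  intro f' hf' ε hε
  obtain ⟨f, hf, hff'⟩ := shwQ_truncTranscoding f' hf'
  filter_upwards [hH f hf ε hε, eventually_ge_atTop 1] with n hn hn1 m hm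
  exact (shwQ_wordRatio_trunc hff' m k hn1).trans (hn m hm)

/-- **The flow.** Hardness at `(k + j, α)` gives hardness at `(k, q · α)` for every `j` and every
integer `q ≥ 1` (iterate `shwQ_hardAt_of_hardAt_succ`, then `shwQ_hardAt_mul_of_hardAt`): the
set of hard parameters is a down-set in the width and an up-set under integer dilations of the
density. [folklore] -/
theorem shwQ_hardAt_flow {k j q : ℕ} (hq : 0 < q) {α : ℝ}
    (hH : ∀ f : List Bool → List Bool, IsPolyTime f → ∀ ε : ℝ, 0 < ε →
      ∀ᶠ n : ℕ in atTop, ∀ m : ℕ, m = ⌊α * n⌋₊ →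
        ((Finset.univ.filter fun Φ : Fin m → Fin (k + j) → Fin n × Bool => ∀ i, ∃ j',
          (f (encodingCNF.encode (List.ofFn fun a => List.ofFn fun b =>
            (((Φ a b).1 : ℕ), (Φ a b).2)))).getD (Φ i j').1 false = (Φ i j').2).card : ℝ) /
          Fintype.card (Fin m → Fin (k + j) → Fin n × Bool) ≤ ε) :
    ∀ f : List Bool → List Bool, IsPolyTime f → ∀ ε : ℝ, 0 < ε →
      ∀ᶠ n : ℕ in atTop, ∀ m : ℕ, m = ⌊(q : ℝ) * α * n⌋₊ →
        ((Finset.univ.filter fun Φ : Fin m → Fin k → Fin n × Bool => ∀ i, ∃ j',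
          (f (encodingCNF.encode (List.ofFn fun a => List.ofFn fun b =>
            (((Φ a b).1 : ℕ), (Φ a b).2)))).getD (Φ i j').1 false = (Φ i j').2).card : ℝ) /
          Fintype.card (Fin m → Fin k → Fin n × Bool) ≤ ε := by
  induction j with
  | zero => exact shwQ_hardAt_mul_of_hardAt hq hH
  | succ j ih => exact ih (shwQ_hardAt_of_hardAt_succ hH)

/-! ## What the flow gives towards the crux -/

/-- **The line's composition, kernel explicit.** For `k ≥ 1024` and `q · α` below the
Achlioptas–Peres radius `ρ_k` of `searchHardWindow_of_hard_below_rho`, hardness of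
`F_{k+j}(n, ⌊α n⌋)` for all of `P` already yields `SearchHardWindow`: the hardness flows to
`(k, q α)` (`shwQ_hardAt_flow`), where satisfiability is uniformly positive
(`achlioptasPeres2004_uniformlyPos`). For `j = 0`, `q = 1` the hypothesis is the crux's own
hardness conjunct; for `j ≥ 1` or `q ≥ 2` it is a STRONGER hardness statement (lower density or
wider clauses), so this is bookkeeping about admissible witnesses, not a weakening of the crux.
[AchlioptasPeres2004, Thm. 2] -/
theorem shwQ_searchHardWindow_of_hardAt_flow {k j q : ℕ} {α : ℝ} (hk : 1024 ≤ k) (hq : 0 < q)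
    (hlt : (q : ℝ) * α < (2 ^ k * Real.log 2 - ((k : ℝ) + 1) * Real.log 2 / 2 - 1) -
      2 * (15 * (k : ℝ) ^ 2 / 2 ^ k + (((k : ℝ) + 3) / 2 ^ k + 32 * (k : ℝ) ^ 2 * (50 / 81) ^ k +
        32 * (k : ℝ) * (5 / 9) ^ k)))
    (hH : ∀ f : List Bool → List Bool, IsPolyTime f → ∀ ε : ℝ, 0 < ε →
      ∀ᶠ n : ℕ in atTop, ∀ m : ℕ, m = ⌊α * n⌋₊ →
        ((Finset.univ.filter fun Φ : Fin m → Fin (k + j) → Fin n × Bool => ∀ i, ∃ j',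
          (f (encodingCNF.encode (List.ofFn fun a => List.ofFn fun b =>
            (((Φ a b).1 : ℕ), (Φ a b).2)))).getD (Φ i j').1 false = (Φ i j').2).card : ℝ) /
          Fintype.card (Fin m → Fin (k + j) → Fin n × Bool) ≤ ε) :
    SearchHardWindow :=
  searchHardWindow_of_hard_below_rho hk hlt (shwQ_hardAt_flow hq hH)

/-- **The kernel of the line is summit-strength.** The same hypothesis (hardness of
`F_{k+j}(n, ⌊α n⌋)` for all of `P`, `k ≥ 1024`, `q α < ρ_k`) proves the summit statement `PneNP`,
through `shwQ_searchHardWindow_of_hardAt_flow` and the route's strength certificate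
`searchHardWindow_implies_pneNP`. So the one stub of line `IdeaSketch_r2_k6` that is not a brick is
the crux core itself (compare `shwK_pneNP_of_kernel` for line `Sketch`). [AroraBarakCC2009, Thm. 2.18] -/
theorem shwQ_pneNP_of_hardAt_flow {k j q : ℕ} {α : ℝ} (hk : 1024 ≤ k) (hq : 0 < q)
    (hlt : (q : ℝ) * α < (2 ^ k * Real.log 2 - ((k : ℝ) + 1) * Real.log 2 / 2 - 1) -
      2 * (15 * (k : ℝ) ^ 2 / 2 ^ k + (((k : ℝ) + 3) / 2 ^ k + 32 * (k : ℝ) ^ 2 * (50 / 81) ^ k +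
        32 * (k : ℝ) * (5 / 9) ^ k)))
    (hH : ∀ f : List Bool → List Bool, IsPolyTime f → ∀ ε : ℝ, 0 < ε →
      ∀ᶠ n : ℕ in atTop, ∀ m : ℕ, m = ⌊α * n⌋₊ →
        ((Finset.univ.filter fun Φ : Fin m → Fin (k + j) → Fin n × Bool => ∀ i, ∃ j',
          (f (encodingCNF.encode (List.ofFn fun a => List.ofFn fun b =>
            (((Φ a b).1 : ℕ), (Φ a b).2)))).getD (Φ i j').1 false = (Φ i j').2).card : ℝ) /
          Fintype.card (Fin m → Fin (k + j) → Fin n × Bool) ≤ ε) :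
    _root_.PneNP :=
  searchHardWindow_implies_pneNP (shwQ_searchHardWindow_of_hardAt_flow hk hq hlt hH)

/-- **The pure width step towards the crux.** Hardness of `F_{k+1}(n, ⌊α n⌋)` for all of `P`
together with uniformly positive satisfiability of `F_k(n, ⌊α n⌋)` witnesses `SearchHardWindow`
at `(k, α)`. (At the densities where `F_{k+1}` is plausibly hard, `α ≳ 2^{k+1} log(k+1)/(k+1)`,
the `k`-instances are unsatisfiable, so this direction carries no witness in practice; recorded for
completeness of the flow.) [folklore] -/
theorem shwQ_searchHardWindow_of_hardAt_succ {k : ℕ} {α : ℝ}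
    (hP : ∃ ε : ℝ, 0 < ε ∧ ∀ᶠ n : ℕ in atTop, ∀ m : ℕ, m = ⌊α * n⌋₊ →
      ε ≤ ((Finset.univ.filter fun Φ : Fin m → Fin k → Fin n × Bool =>
        ∃ σ : Fin n → Bool, ∀ i, ∃ j, σ (Φ i j).1 = (Φ i j).2).card : ℝ) /
          Fintype.card (Fin m → Fin k → Fin n × Bool))
    (hH : ∀ f : List Bool → List Bool, IsPolyTime f → ∀ ε : ℝ, 0 < ε →
      ∀ᶠ n : ℕ in atTop, ∀ m : ℕ, m = ⌊α * n⌋₊ →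
        ((Finset.univ.filter fun Φ : Fin m → Fin (k + 1) → Fin n × Bool => ∀ i, ∃ j,
          (f (encodingCNF.encode (List.ofFn fun a => List.ofFn fun b =>
            (((Φ a b).1 : ℕ), (Φ a b).2)))).getD (Φ i j).1 false = (Φ i j).2).card : ℝ) /
          Fintype.card (Fin m → Fin (k + 1) → Fin n × Bool) ≤ ε) :
    SearchHardWindow :=
  ⟨k, α, hP, shwQ_hardAt_of_hardAt_succ hH⟩

end Summit.PneNP.PneNP.Theorems
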